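import Summits.CriticalPhenomena.PercolationContinuityZ3.Theorems.PercNearOneGluingNoHeavyLowerTailThreePartitionRobustSections
import Summits.CriticalPhenomena.PercolationContinuityZ3.Theorems.PercNearOneGluingNoHeavyLowerTailThreePartitionRobustTwoThread

/-!
# THEOREM A, the induction step at an UNTWISTED coordinate (lineage `prim-bnk-2`, generation 25)

Support file (`--supports stmt-CriticalPhenomena-4575`; memo `FROM-prim-bnk-2-g25-ROBUST-MATCHING.md` §2 (U)).  No `sorry`, standard axioms.
From increasing bijections for the three section instances `(G,H¹;σ¹)`, `(G,H;σ)`, `(G¹,H;σ)` on `s'` an increasing bijection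
`N(G,H) → P(G,H;σ)` on `insert e s'` (`e ∉ τ`) is GLUED: the `e`-free sources of `N(G,H¹)` stay `e`-free (instance `(G,H¹;σ¹)`);
the other `e`-free sources hop into the threads `e ∈ a` / `e ∈ b`, the split and the thread bijections being supplied by the
two-thread lemma (`…RobustTwoThread`) applied to the core `(G,H;σ)` and the enlarged instance `(G¹,H;σ)`. [this work]
-/

namespace Summit.CriticalPhenomena.PercolationContinuityZ3.Theorems.ThreePartition

open Finset Function
open scoped Classical

noncomputable section

variable {ι : Type*} [Fintype ι]

/-! ## The induction step at an UNTWISTED coordinate -/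

section StepU

variable (τ : Set ι) {s' : Finset ι} {e : ι}

omit [Fintype ι] in
/-- Extensions of faces of `s'` are equal iff the values at `e` and the faces agree. [this work] -/
theorem update_inj_of_isFace (he : e ∉ s') {x y : ι → Fin 3} (hx : x ∈ faces s') (hy : y ∈ faces s') {k k' : Fin 3}
    (h : update x e k = update y e k') : k = k' ∧ x = y := by
  have h1 : k = k' := by have := congrFun h e; rwa [update_self, update_self] at this
  refine ⟨h1, ?_⟩
  have h2 := congrArg (fun ω => update ω e (0 : Fin 3)) h
  simp only [update_idem] at h2
  rwa [update_eq_self_of_faces he hx, update_eq_self_of_faces he hy] at h2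

/-- **Induction step of THEOREM A at an untwisted coordinate** (`e ∉ τ`, `e ∉ s'`): from the three section instances
`(G,H¹;σ¹)`, `(G,H;σ)`, `(G¹,H;σ)` on `s'` to the instance `(G,H;σ)` on `insert e s'` (memo §2 (U): the `e`-free sources in
`N(G,H¹)` stay in the `e`-free slice; the other `e`-free sources hop into the threads `e ∈ a` / `e ∈ b`, split by the
two-thread lemma applied to the core `(G,H;σ)` and the enlarged instance `(G¹,H;σ)`). [this work] -/
theorem step_untwisted (he : e ∉ s') (heτ : e ∉ τ) {G H : Set (Set ι)} (hG : IsUpperSet G) (hH : IsUpperSet H)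
    (σ : Set ι → Bool)
    (ihB : ∃ f : (ι → Fin 3) → (ι → Fin 3),
      Set.BijOn f ↑(Nfam τ s' G ((fun u : Set ι => insert e u) ⁻¹' H))
        ↑(Pfam τ s' ((fun u : Set ι => insert e u) ⁻¹' H) G G (fun c => σ (insert e c))) ∧
      ∀ ω ∈ Nfam τ s' G ((fun u : Set ι => insert e u) ⁻¹' H), f ω ∈ above τ s' ω)
    (ih0 : ∃ f : (ι → Fin 3) → (ι → Fin 3), Set.BijOn f ↑(Nfam τ s' G H) ↑(Pfam τ s' H G G σ) ∧
      ∀ ω ∈ Nfam τ s' G H, f ω ∈ above τ s' ω)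
    (ih1 : ∃ f : (ι → Fin 3) → (ι → Fin 3),
      Set.BijOn f ↑(Nfam τ s' ((fun u : Set ι => insert e u) ⁻¹' G) H)
        ↑(Pfam τ s' H ((fun u : Set ι => insert e u) ⁻¹' G) ((fun u : Set ι => insert e u) ⁻¹' G) σ) ∧
      ∀ ω ∈ Nfam τ s' ((fun u : Set ι => insert e u) ⁻¹' G) H, f ω ∈ above τ s' ω) :
    ∃ f : (ι → Fin 3) → (ι → Fin 3), Set.BijOn f ↑(Nfam τ (insert e s') G H) ↑(Pfam τ (insert e s') H G G σ) ∧
      ∀ ω ∈ Nfam τ (insert e s') G H, f ω ∈ above τ (insert e s') ω := by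
  obtain ⟨fB, hB, hBm⟩ := ihB
  obtain ⟨f0, h0, h0m⟩ := ih0
  obtain ⟨f1, h1, h1m⟩ := ih1
  set G1 : Set (Set ι) := (fun u : Set ι => insert e u) ⁻¹' G with hG1
  set H1 : Set (Set ι) := (fun u : Set ι => insert e u) ⁻¹' H with hH1
  set σ1 : Set ι → Bool := fun c => σ (insert e c) with hσ1
  set N01 := Nfam τ s' G H1 with hN01
  set N00 := Nfam τ s' G H with hN00
  set N10 := Nfam τ s' G1 H with hN10
  set P011 := Pfam τ s' H1 G G σ1 with hP011
  set P00 := Pfam τ s' H G G σ with hP00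
  set P10 := Pfam τ s' H G1 G1 σ with hP10
  set Pa := Pfam τ s' H G1 G σ with hPa
  set Pb := Pfam τ s' H G G1 σ with hPb
  have hN1 : N01 ⊆ N00 := Nfam_mono_H τ s' e hH
  have hN2 : N00 ⊆ N10 := Nfam_mono_G τ s' e hG
  set D := N10 \ N00 with hD
  set Xa := (P10 \ P00).filter (fun ω => σ (cp τ s' 2 ω) = false) with hXa
  set Xb := (P10 \ P00).filter (fun ω => σ (cp τ s' 2 ω) = true) with hXb
  have hNDun : N00 ∪ D = N10 := Finset.union_sdiff_of_subset hN2
  have hPsplit : P00 ∪ Xa ∪ Xb = P10 := Pfam_split τ s' e σ hG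
  have hPaeq : P00 ∪ Xa = Pa := Pfam_thread_a τ s' e σ hG
  have hPbeq : P00 ∪ Xb = Pb := Pfam_thread_b τ s' e σ hG
  have hND : Disjoint N00 D := Finset.disjoint_sdiff
  have hPXa : Disjoint P00 Xa := Finset.disjoint_of_subset_right (Finset.filter_subset _ _) Finset.disjoint_sdiff
  have hPXb : Disjoint P00 Xb := Finset.disjoint_of_subset_right (Finset.filter_subset _ _) Finset.disjoint_sdiff
  have hab : Disjoint Xa Xb := by
    rw [Finset.disjoint_left]; intro ω ha hb
    rw [Finset.mem_filter] at ha hb; rw [ha.2] at hb; exact Bool.false_ne_true hb.2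
  have h1' : Set.BijOn f1 ↑(N00 ∪ D) ↑(P00 ∪ Xa ∪ Xb) := by rw [hNDun, hPsplit]; exact h1
  obtain ⟨Da, Db, α, β, hDab, hdisj, hα, hβ, hαm, hβm⟩ :=
    two_thread_rel N00 P00 D Xa Xb f0 f1 (fun x y => y ∈ above τ s' x) hND hPXa hPXb hab h0 h1' h0m
      (fun x hx => h1m x (by rw [hNDun] at hx; exact hx))
  rw [hPaeq] at hα; rw [hPbeq] at hβ
  have hDaD : Da ⊆ D := by rw [← hDab]; exact Finset.subset_union_left
  have hDbD : Db ⊆ D := by rw [← hDab]; exact Finset.subset_union_right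
  -- the glued map
  let f : (ι → Fin 3) → (ι → Fin 3) := fun ω =>
    if ω e = 2 then
      (if update ω e 0 ∈ N01 then update (fB (update ω e 0)) e 2
       else if update ω e 0 ∈ Db then update (β (update ω e 0)) e 1
       else update (α (update ω e 0)) e 0)
    else if ω e = 1 then update (β (update ω e 0)) e 1
    else update (α (update ω e 0)) e 0
  have hf0 : ∀ ω : ι → Fin 3, ω e = 0 → f ω = update (α (update ω e 0)) e 0 := fun ω h => by
    simp only [f, h]; simp
  have hf1 : ∀ ω : ι → Fin 3, ω e = 1 → f ω = update (β (update ω e 0)) e 1 := fun ω h => by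
    simp only [f, h]; simp
  have hf2B : ∀ ω : ι → Fin 3, ω e = 2 → update ω e 0 ∈ N01 → f ω = update (fB (update ω e 0)) e 2 :=
    fun ω h hm => by simp only [f, h, hm]; simp
  have hf2b : ∀ ω : ι → Fin 3, ω e = 2 → update ω e 0 ∉ N01 → update ω e 0 ∈ Db →
      f ω = update (β (update ω e 0)) e 1 := fun ω h hm hd => by simp only [f, h, hm, hd]; simp
  have hf2a : ∀ ω : ι → Fin 3, ω e = 2 → update ω e 0 ∉ N01 → update ω e 0 ∉ Db →
      f ω = update (α (update ω e 0)) e 0 := fun ω h hm hd => by simp only [f, h, hm, hd]; simp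
  have h3 : ∀ k : Fin 3, k = 0 ∨ k = 1 ∨ k = 2 := by decide
  have hωeq : ∀ ω : ι → Fin 3, update (update ω e 0) e (ω e) = ω := fun ω => update_update_eq_self ω
  set N := Nfam τ (insert e s') G H with hN
  set P := Pfam τ (insert e s') H G G σ with hP
  -- faces
  have hfaN : ∀ ω ∈ N, update ω e 0 ∈ faces s' := fun ω hω => faces_update_zero he (faces_of_mem_Nfam τ G H hω)
  have hfaP : ∀ π ∈ P, update π e 0 ∈ faces s' := fun π hπ => faces_update_zero he (faces_of_mem_Pfam τ H G G σ hπ)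
  -- source classification
  have hs0 : ∀ ω ∈ N, ω e = 0 → update ω e 0 ∈ N01 := fun ω hω h0 => by
    have h := hω; rw [← hωeq ω, h0] at h; exact (mem_Nfam_ext0 τ G H he heτ (hfaN ω hω)).1 h
  have hs1 : ∀ ω ∈ N, ω e = 1 → update ω e 0 ∈ N00 := fun ω hω h1 => by
    have h := hω; rw [← hωeq ω, h1] at h; exact (mem_Nfam_ext1 τ G H he heτ (hfaN ω hω)).1 h
  have hs2 : ∀ ω ∈ N, ω e = 2 → update ω e 0 ∈ N10 := fun ω hω h2 => by
    have h := hω; rw [← hωeq ω, h2] at h; exact (mem_Nfam_ext2 τ G H he heτ (hfaN ω hω)).1 h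
  -- target classification
  have ht0 : ∀ y ∈ Pa, update y e 0 ∈ P := fun y hy =>
    (mem_Pfam_ext0 τ H G G σ he heτ (faces_of_mem_Pfam τ H G1 G σ hy)).2 hy
  have ht1 : ∀ y ∈ Pb, update y e 1 ∈ P := fun y hy =>
    (mem_Pfam_ext1 τ H G G σ he heτ (faces_of_mem_Pfam τ H G G1 σ hy)).2 hy
  have ht2 : ∀ y ∈ P011, update y e 2 ∈ P := fun y hy =>
    (mem_Pfam_ext2 τ H G G σ he heτ (faces_of_mem_Pfam τ H1 G G σ1 hy)).2 hy
  have hu0 : ∀ π ∈ P, π e = 0 → update π e 0 ∈ Pa := fun π hπ h0 => by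
    have h := hπ; rw [← hωeq π, h0] at h; exact (mem_Pfam_ext0 τ H G G σ he heτ (hfaP π hπ)).1 h
  have hu1 : ∀ π ∈ P, π e = 1 → update π e 0 ∈ Pb := fun π hπ h1 => by
    have h := hπ; rw [← hωeq π, h1] at h; exact (mem_Pfam_ext1 τ H G G σ he heτ (hfaP π hπ)).1 h
  have hu2 : ∀ π ∈ P, π e = 2 → update π e 0 ∈ P011 := fun π hπ h2 => by
    have h := hπ; rw [← hωeq π, h2] at h; exact (mem_Pfam_ext2 τ H G G σ he heτ (hfaP π hπ)).1 h
  -- membership bookkeeping between the pieces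
  have hDN : ∀ x ∈ D, x ∉ N00 := fun x hx => (Finset.mem_sdiff.1 hx).2
  have hDN10 : ∀ x ∈ D, x ∈ N10 := fun x hx => (Finset.mem_sdiff.1 hx).1
  have hN01Db : ∀ x ∈ N01, x ∉ Db := fun x hx hd => hDN x (hDbD hd) (hN1 hx)
  have hN00Db : ∀ x ∈ N00, x ∉ Db := fun x hx hd => hDN x (hDbD hd) hx
  have hDaN01 : ∀ x ∈ Da, x ∉ N01 := fun x hx h => hDN x (hDaD hx) (hN1 h)
  have hDaDb : ∀ x ∈ Da, x ∉ Db := fun x hx h => Finset.disjoint_left.1 hdisj hx h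
  have hthA : ∀ x ∈ N10, x ∉ N01 → x ∉ Db → x ∈ N00 ∪ Da := fun x hx h1 h2 => by
    rw [← hNDun, ← hDab, ← Finset.union_assoc] at hx
    rcases Finset.mem_union.1 hx with h | h
    · exact h
    · exact absurd h h2
  -- classification of the glued map on sources
  have hclass : ∀ ω ∈ N,
      (f ω = update (α (update ω e 0)) e 0 ∧ update ω e 0 ∈ N00 ∪ Da ∧
        (ω e = 0 ∧ update ω e 0 ∈ N01 ∨ ω e = 2 ∧ update ω e 0 ∉ N01)) ∨
      (f ω = update (β (update ω e 0)) e 1 ∧ update ω e 0 ∈ N00 ∪ Db ∧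
        (ω e = 1 ∧ update ω e 0 ∈ N00 ∨ ω e = 2 ∧ update ω e 0 ∈ Db)) ∨
      (f ω = update (fB (update ω e 0)) e 2 ∧ update ω e 0 ∈ N01 ∧ ω e = 2) := by
    intro ω hω
    rcases h3 (ω e) with h | h | h
    · left
      exact ⟨hf0 ω h, Finset.mem_union_left _ (hN1 (hs0 ω hω h)), Or.inl ⟨h, hs0 ω hω h⟩⟩
    · right; left
      exact ⟨hf1 ω h, Finset.mem_union_left _ (hs1 ω hω h), Or.inl ⟨h, hs1 ω hω h⟩⟩
    · by_cases hm : update ω e 0 ∈ N01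
      · right; right; exact ⟨hf2B ω h hm, hm, h⟩
      · by_cases hd : update ω e 0 ∈ Db
        · right; left; exact ⟨hf2b ω h hm hd, Finset.mem_union_right _ hd, Or.inr ⟨h, hd⟩⟩
        · left; exact ⟨hf2a ω h hm hd, hthA _ (hs2 ω hω h) hm hd, Or.inr ⟨h, hm⟩⟩
  refine ⟨f, Set.BijOn.mk ?_ ?_ ?_, ?_⟩
  · -- MapsTo
    intro ω hω
    have hω' : ω ∈ N := by exact_mod_cast hω
    rcases hclass ω hω' with ⟨hfe, hmem, -⟩ | ⟨hfe, hmem, -⟩ | ⟨hfe, hmem, -⟩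
    · rw [hfe]; exact_mod_cast ht0 _ (hα.mapsTo (by exact_mod_cast hmem))
    · rw [hfe]; exact_mod_cast ht1 _ (hβ.mapsTo (by exact_mod_cast hmem))
    · rw [hfe]; exact_mod_cast ht2 _ (hB.mapsTo (by exact_mod_cast hmem))
  · -- InjOn
    intro ω₁ hω₁ ω₂ hω₂ hfeq
    have hω₁' : ω₁ ∈ N := by exact_mod_cast hω₁
    have hω₂' : ω₂ ∈ N := by exact_mod_cast hω₂
    have faα : ∀ x ∈ N00 ∪ Da, α x ∈ faces s' := fun x hx =>
      faces_of_mem_Pfam τ H G1 G σ (by exact_mod_cast hα.mapsTo (by exact_mod_cast hx))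
    have faβ : ∀ x ∈ N00 ∪ Db, β x ∈ faces s' := fun x hx =>
      faces_of_mem_Pfam τ H G G1 σ (by exact_mod_cast hβ.mapsTo (by exact_mod_cast hx))
    have faB : ∀ x ∈ N01, fB x ∈ faces s' := fun x hx =>
      faces_of_mem_Pfam τ H1 G G σ1 (by exact_mod_cast hB.mapsTo (by exact_mod_cast hx))
    have key : update ω₁ e 0 = update ω₂ e 0 → ω₁ e = ω₂ e → ω₁ = ω₂ := fun hr hs => by
      rw [← hωeq ω₁, ← hωeq ω₂, hr, hs]
    rcases hclass ω₁ hω₁' with ⟨hf₁, hm₁, ht₁⟩ | ⟨hf₁, hm₁, ht₁⟩ | ⟨hf₁, hm₁, ht₁⟩ <;>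
      rcases hclass ω₂ hω₂' with ⟨hf₂, hm₂, ht₂⟩ | ⟨hf₂, hm₂, ht₂⟩ | ⟨hf₂, hm₂, ht₂⟩ <;>
      rw [hf₁, hf₂] at hfeq
    · obtain ⟨-, hxy⟩ := update_inj_of_isFace he (faα _ hm₁) (faα _ hm₂) hfeq
      have hr : update ω₁ e 0 = update ω₂ e 0 := hα.injOn (by exact_mod_cast hm₁) (by exact_mod_cast hm₂) hxy
      refine key hr ?_
      rcases ht₁ with ⟨h₁, m₁⟩ | ⟨h₁, m₁⟩ <;> rcases ht₂ with ⟨h₂, m₂⟩ | ⟨h₂, m₂⟩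
      · rw [h₁, h₂]
      · exact absurd (hr ▸ m₁) m₂
      · exact absurd (hr ▸ m₂) m₁
      · rw [h₁, h₂]
    · exact absurd (update_inj_of_isFace he (faα _ hm₁) (faβ _ hm₂) hfeq).1 (by decide)
    · exact absurd (update_inj_of_isFace he (faα _ hm₁) (faB _ hm₂) hfeq).1 (by decide)
    · exact absurd (update_inj_of_isFace he (faβ _ hm₁) (faα _ hm₂) hfeq).1 (by decide)
    · obtain ⟨-, hxy⟩ := update_inj_of_isFace he (faβ _ hm₁) (faβ _ hm₂) hfeq
      have hr : update ω₁ e 0 = update ω₂ e 0 := hβ.injOn (by exact_mod_cast hm₁) (by exact_mod_cast hm₂) hxy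
      refine key hr ?_
      rcases ht₁ with ⟨h₁, m₁⟩ | ⟨h₁, m₁⟩ <;> rcases ht₂ with ⟨h₂, m₂⟩ | ⟨h₂, m₂⟩
      · rw [h₁, h₂]
      · exact absurd (hr ▸ m₁) (hDN _ (hDbD m₂))
      · exact absurd (hr ▸ m₂) (hDN _ (hDbD m₁))
      · rw [h₁, h₂]
    · exact absurd (update_inj_of_isFace he (faβ _ hm₁) (faB _ hm₂) hfeq).1 (by decide)
    · exact absurd (update_inj_of_isFace he (faB _ hm₁) (faα _ hm₂) hfeq).1 (by decide)
    · exact absurd (update_inj_of_isFace he (faB _ hm₁) (faβ _ hm₂) hfeq).1 (by decide)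
    · obtain ⟨-, hxy⟩ := update_inj_of_isFace he (faB _ hm₁) (faB _ hm₂) hfeq
      have hr : update ω₁ e 0 = update ω₂ e 0 := hB.injOn (by exact_mod_cast hm₁) (by exact_mod_cast hm₂) hxy
      exact key hr (by rw [ht₁, ht₂])
  · -- SurjOn
    intro π hπ
    have hπ' : π ∈ P := by exact_mod_cast hπ
    have hπf := hfaP π hπ'
    rcases h3 (π e) with h | h | h
    · obtain ⟨x, hx, hxe⟩ := hα.surjOn (by exact_mod_cast hu0 π hπ' h : update π e 0 ∈ (↑Pa : Set (ι → Fin 3)))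
      have hx' : x ∈ N00 ∪ Da := by exact_mod_cast hx
      have hxf : x ∈ faces s' := by
        rcases Finset.mem_union.1 hx' with h' | h'
        · exact faces_of_mem_Nfam τ G H h'
        · exact faces_of_mem_Nfam τ G1 H (hDN10 _ (hDaD h'))
      have hxu : update x e 0 = x := update_eq_self_of_faces he hxf
      by_cases hx01 : x ∈ N01
      · refine ⟨update x e 0, ?_, ?_⟩
        · exact_mod_cast (mem_Nfam_ext0 τ G H he heτ hxf).2 hx01
        · rw [hf0 _ (by rw [update_self]), update_idem, hxu, hxe, update_update_of_apply_eq π h]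
      · have hx2 : update x e 2 ∈ N := by
          refine (mem_Nfam_ext2 τ G H he heτ hxf).2 ?_
          rcases Finset.mem_union.1 hx' with h' | h'
          · exact hN2 h'
          · exact hDN10 _ (hDaD h')
        have hxDb : x ∉ Db := by
          rcases Finset.mem_union.1 hx' with h' | h'
          · exact hN00Db _ h'
          · exact hDaDb _ h'
        refine ⟨update x e 2, by exact_mod_cast hx2, ?_⟩
        rw [hf2a _ (by rw [update_self]) (by rw [update_idem, hxu]; exact hx01) (by rw [update_idem, hxu]; exact hxDb),
          update_idem, hxu, hxe, update_update_of_apply_eq π h]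
    · obtain ⟨x, hx, hxe⟩ := hβ.surjOn (by exact_mod_cast hu1 π hπ' h : update π e 0 ∈ (↑Pb : Set (ι → Fin 3)))
      have hx' : x ∈ N00 ∪ Db := by exact_mod_cast hx
      rcases Finset.mem_union.1 hx' with h' | h'
      · have hxf : x ∈ faces s' := faces_of_mem_Nfam τ G H h'
        have hxu : update x e 0 = x := update_eq_self_of_faces he hxf
        refine ⟨update x e 1, by exact_mod_cast (mem_Nfam_ext1 τ G H he heτ hxf).2 h', ?_⟩
        rw [hf1 _ (by rw [update_self]), update_idem, hxu, hxe, update_update_of_apply_eq π h]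
      · have hxf : x ∈ faces s' := faces_of_mem_Nfam τ G1 H (hDN10 _ (hDbD h'))
        have hxu : update x e 0 = x := update_eq_self_of_faces he hxf
        have hx2 : update x e 2 ∈ N := (mem_Nfam_ext2 τ G H he heτ hxf).2 (hDN10 _ (hDbD h'))
        refine ⟨update x e 2, by exact_mod_cast hx2, ?_⟩
        have hx01 : x ∉ N01 := fun hh => hDN _ (hDbD h') (hN1 hh)
        rw [hf2b _ (by rw [update_self]) (by rw [update_idem, hxu]; exact hx01) (by rw [update_idem, hxu]; exact h'),
          update_idem, hxu, hxe, update_update_of_apply_eq π h]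
    · obtain ⟨x, hx, hxe⟩ := hB.surjOn (by exact_mod_cast hu2 π hπ' h : update π e 0 ∈ (↑P011 : Set (ι → Fin 3)))
      have hx' : x ∈ N01 := by exact_mod_cast hx
      have hxf : x ∈ faces s' := faces_of_mem_Nfam τ G H1 hx'
      have hxu : update x e 0 = x := update_eq_self_of_faces he hxf
      have hx2 : update x e 2 ∈ N := (mem_Nfam_ext2 τ G H he heτ hxf).2 (hN2 (hN1 hx'))
      refine ⟨update x e 2, by exact_mod_cast hx2, ?_⟩
      rw [hf2B _ (by rw [update_self]) (by rw [update_idem, hxu]; exact hx'), update_idem, hxu, hxe, update_update_of_apply_eq π h]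
  · -- monotone
    intro ω hω
    have faα : ∀ x ∈ N00 ∪ Da, α x ∈ faces s' := fun x hx =>
      faces_of_mem_Pfam τ H G1 G σ (by exact_mod_cast hα.mapsTo (by exact_mod_cast hx))
    have faβ : ∀ x ∈ N00 ∪ Db, β x ∈ faces s' := fun x hx =>
      faces_of_mem_Pfam τ H G G1 σ (by exact_mod_cast hβ.mapsTo (by exact_mod_cast hx))
    have faB : ∀ x ∈ N01, fB x ∈ faces s' := fun x hx =>
      faces_of_mem_Pfam τ H1 G G σ1 (by exact_mod_cast hB.mapsTo (by exact_mod_cast hx))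
    rcases hclass ω hω with ⟨hfe, hmem, htag⟩ | ⟨hfe, hmem, htag⟩ | ⟨hfe, hmem, htag⟩
    · refine mem_above_insert_of τ he ?_ ?_ ?_
      · rw [hfe, update_idem, update_eq_self_of_faces he (faα _ hmem)]; exact hαm _ hmem
      · intro _; rw [hfe, update_self]; simp [heτ]
      · intro h1; rw [hfe, update_self]
        have : ω e = 1 := by simpa [heτ] using h1
        rcases htag with ⟨h, -⟩ | ⟨h, -⟩ <;> rw [h] at this <;> exact absurd this (by decide)
    · refine mem_above_insert_of τ he ?_ ?_ ?_
      · rw [hfe, update_idem, update_eq_self_of_faces he (faβ _ hmem)]; exact hβm _ hmem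
      · intro h0; rw [hfe, update_self]
        have : ω e = 0 := by simpa [heτ] using h0
        rcases htag with ⟨h, -⟩ | ⟨h, -⟩ <;> rw [h] at this <;> exact absurd this (by decide)
      · intro _; rw [hfe, update_self]; simp [heτ]
    · refine mem_above_insert_of τ he ?_ ?_ ?_
      · rw [hfe, update_idem, update_eq_self_of_faces he (faB _ hmem)]; exact hBm _ hmem
      · intro h0; have : ω e = 0 := by simpa [heτ] using h0
        rw [htag] at this; exact absurd this (by decide)
      · intro h1; have : ω e = 1 := by simpa [heτ] using h1
        rw [htag] at this; exact absurd this (by decide)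

end StepU

end

end Summit.CriticalPhenomena.PercolationContinuityZ3.Theorems.ThreePartition
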